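import Literature.NumberTheory.DiophantineApproximation.ViolaZudilinResidueIntegrals
import Literature.Analysis.SpecialFunctions.HypergeometricEulerTransformation
import HarnessLib

/-!
# The hypergeometric transformation `ϕ` for the real Viola–Zudilin integral `J_z^{(0)}`

Topic `Literature/NumberTheory/DiophantineApproximation`. PROVED theorems only; no new definitions,
no named facts.

* `RhinViola.euler_integral_symm_nat` — Rhin–Viola's (3.3)/(3.4): for naturals `p + r = p' + r'`
  and real `t < 1`,
  `p'! r'! ∫₀¹ x^p (1−x)^r dx/(1 − xt)^{p'+1} = p! r! ∫₀¹ x^{p'} (1−x)^{r'} dx/(1 − xt)^{p+1}`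
  — the symmetry `E(a,b;c;z) = E(b,a;c;z)` of Euler's integral representation of `₂F₁`
  (tree: `Hypergeometric.eulerHypergeometric_symm`, on `Re z < 1`) at `a = p'+1`, `b = p+1`,
  `c = p+r+2`, with `Γ` at naturals evaluated as factorials.
* `RhinViola.euler_integral_symm_denom` — the same with `t = (y−1)/(yz)`, i.e. with Rhin–Viola's
  denominator `x(1−y)+yz = yz(1 − xt)` ((3.4) multiplied out).
* `ViolaZudilin.J₀_phi` — **Viola–Zudilin Lemma 3.2 for `μ = 0` at real `z > 1`** (= Rhin–Viola (3.5)
  with the extra factor `(1−y+yz)^{j+q−m}`, which does not involve `x`):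
  `(h+m−k)! (j+k−m)! · J_z^{(0)}(h,j,k,l,m,q) = h! j! · J_z^{(0)}(h+m−k, j+k−m, m, l, k, q)`,
  i.e. `J_z^{(0)}(h,j,k,l,m,q)/(h!j!)` is invariant under `ϕ = (h h+m−k)(j j+k−m)(k m)`.

## References

* C. Viola, W. Zudilin, J. reine angew. Math. 736 (2018) 193–223, Lemma 3.2. [ViolaZudilin2018]
* G. Rhin, C. Viola, Ann. Sc. Norm. Super. Pisa Cl. Sci. (5) 4 (2005) 389–437, (3.3)–(3.5).
  [RhinViola2005]
* NIST DLMF 15.6.1 (Euler's integral). [DLMF]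
-/

noncomputable section

namespace Literature.NumberTheory.DiophantineApproximation

open _root_.MeasureTheory _root_.Set intervalIntegral
open scoped Nat
open Literature.Analysis.SpecialFunctions.Hypergeometric (eulerHypergeometric eulerIntegral eulerIntegrand
  eulerHypergeometric_symm)

namespace RhinViola

/-- The Euler integrand at natural parameters is the real rational integrand. [cite: DLMF, 15.6.1] -/
theorem eulerIntegrand_nat (p r a : ℕ) (t x : ℝ) :
    eulerIntegrand ((a : ℂ)) ((p : ℂ) + 1) ((p : ℂ) + r + 2) (t : ℂ) x =
      ((x ^ p * (1 - x) ^ r / (1 - x * t) ^ a : ℝ) : ℂ) := by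
  rw [eulerIntegrand, show ((p : ℂ) + 1 - 1) = (p : ℂ) by ring, show ((p : ℂ) + r + 2 - ((p : ℂ) + 1) - 1) = (r : ℂ)
    by ring, Complex.cpow_natCast, Complex.cpow_natCast, Complex.cpow_neg, Complex.cpow_natCast]
  push_cast
  rw [div_eq_mul_inv, mul_comm (t : ℂ)]

/-- The Euler integral at natural parameters is the real integral. [cite: DLMF, 15.6.1] -/
theorem eulerIntegral_nat (p r a : ℕ) (t : ℝ) :
    eulerIntegral ((a : ℂ)) ((p : ℂ) + 1) ((p : ℂ) + r + 2) (t : ℂ) =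
      ((∫ x in (0 : ℝ)..1, x ^ p * (1 - x) ^ r / (1 - x * t) ^ a : ℝ) : ℂ) := by
  rw [eulerIntegral]
  simp_rw [eulerIntegrand_nat]
  exact intervalIntegral.integral_ofReal

/-- **Rhin–Viola (3.3)/(3.4), natural parameters**: for `p + r = p' + r'` and real `t < 1`,
`p'! r'! ∫₀¹ x^p(1−x)^r/(1−xt)^{p'+1} dx = p! r! ∫₀¹ x^{p'}(1−x)^{r'}/(1−xt)^{p+1} dx` (the symmetry of
`₂F₁(a,b;c;t)` in `a, b` in Euler-integral form, `a = p'+1`, `b = p+1`, `c = p+r+2`).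
[cite: RhinViola2005, (3.3)–(3.4)] -/
theorem euler_integral_symm_nat {p r p' r' : ℕ} (hpr : p + r = p' + r') {t : ℝ} (ht : t < 1) :
    ((p' ! : ℝ) * r' !) * ∫ x in (0 : ℝ)..1, x ^ p * (1 - x) ^ r / (1 - x * t) ^ (p' + 1) =
      ((p ! : ℝ) * r !) * ∫ x in (0 : ℝ)..1, x ^ p' * (1 - x) ^ r' / (1 - x * t) ^ (p + 1) := by
  -- the complex identity `E(a,b;c;t) = E(b,a;c;t)`
  have key := eulerHypergeometric_symm (a := (p' : ℂ) + 1) (b := (p : ℂ) + 1) (c := (p : ℂ) + r + 2)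
    (by norm_cast; omega) (by norm_cast; omega) (by norm_cast; omega) (by norm_cast; omega)
    (z := (t : ℂ)) (by simpa using ht)
  have hc' : ((p : ℂ) + r + 2) = (p' : ℂ) + r' + 2 := by norm_cast; omega
  have h1 : eulerHypergeometric ((p' : ℂ) + 1) ((p : ℂ) + 1) ((p : ℂ) + r + 2) (t : ℂ) =
      (((p + r + 1)! : ℕ) : ℂ) / ((p ! : ℂ) * r !) *
        ((∫ x in (0 : ℝ)..1, x ^ p * (1 - x) ^ r / (1 - x * t) ^ (p' + 1) : ℝ) : ℂ) := by
    rw [eulerHypergeometric, show ((p' : ℂ) + 1) = ((p' + 1 : ℕ) : ℂ) by push_cast; ring, eulerIntegral_nat,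
      show ((p : ℂ) + r + 2) = ((p + r + 1 : ℕ) : ℂ) + 1 by push_cast; ring,
      show ((p + r + 1 : ℕ) : ℂ) + 1 - ((p : ℂ) + 1) = (r : ℂ) + 1 by push_cast; ring,
      Complex.Gamma_nat_eq_factorial, Complex.Gamma_nat_eq_factorial, Complex.Gamma_nat_eq_factorial]
  have h2 : eulerHypergeometric ((p : ℂ) + 1) ((p' : ℂ) + 1) ((p : ℂ) + r + 2) (t : ℂ) =
      (((p + r + 1)! : ℕ) : ℂ) / ((p' ! : ℂ) * r' !) *
        ((∫ x in (0 : ℝ)..1, x ^ p' * (1 - x) ^ r' / (1 - x * t) ^ (p + 1) : ℝ) : ℂ) := by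
    rw [hc', eulerHypergeometric, show ((p : ℂ) + 1) = ((p + 1 : ℕ) : ℂ) by push_cast; ring, eulerIntegral_nat,
      show ((p' : ℂ) + r' + 2) = ((p' + r' + 1 : ℕ) : ℂ) + 1 by push_cast; ring,
      show ((p' + r' + 1 : ℕ) : ℂ) + 1 - ((p' : ℂ) + 1) = (r' : ℂ) + 1 by push_cast; ring,
      Complex.Gamma_nat_eq_factorial, Complex.Gamma_nat_eq_factorial, Complex.Gamma_nat_eq_factorial,
      show p' + r' + 1 = p + r + 1 by omega]
  rw [h1, h2] at key
  set I₁ : ℝ := ∫ x in (0 : ℝ)..1, x ^ p * (1 - x) ^ r / (1 - x * t) ^ (p' + 1) with hI₁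
  set I₂ : ℝ := ∫ x in (0 : ℝ)..1, x ^ p' * (1 - x) ^ r' / (1 - x * t) ^ (p + 1) with hI₂
  have hF : (((p + r + 1)! : ℕ) : ℂ) ≠ 0 := by exact_mod_cast (Nat.factorial_pos _).ne'
  have hp : (p ! : ℂ) ≠ 0 := by exact_mod_cast (Nat.factorial_pos _).ne'
  have hr : (r ! : ℂ) ≠ 0 := by exact_mod_cast (Nat.factorial_pos _).ne'
  have hp' : (p' ! : ℂ) ≠ 0 := by exact_mod_cast (Nat.factorial_pos _).ne'
  have hr' : (r' ! : ℂ) ≠ 0 := by exact_mod_cast (Nat.factorial_pos _).ne'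
  have key' : (((p' ! : ℝ) * r' !) * I₁ : ℝ) = ((((p ! : ℝ) * r !) * I₂ : ℝ) : ℂ) := by
    push_cast
    field_simp at key
    linear_combination key
  exact_mod_cast key'

/-- `1 − x·(y−1)/(yz) = (x(1−y)+yz)/(yz)`. [cite: RhinViola2005, (3.4)] -/
theorem one_sub_mul_t {y z : ℝ} (hy : y ≠ 0) (hz : z ≠ 0) (x : ℝ) :
    1 - x * ((y - 1) / (y * z)) = (x * (1 - y) + y * z) / (y * z) := by
  field_simp
  ring

/-- The Euler integral at `t = (y−1)/(yz)` in Rhin–Viola's denominator: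
`∫₀¹ x^p(1−x)^r/(1−xt)^a dx = (yz)^a ∫₀¹ x^p(1−x)^r dx/(x(1−y)+yz)^a`. [cite: RhinViola2005, (3.4)] -/
theorem euler_integral_denom {y z : ℝ} (hy : y ≠ 0) (hz : z ≠ 0) (p r a : ℕ) :
    ∫ x in (0 : ℝ)..1, x ^ p * (1 - x) ^ r / (1 - x * ((y - 1) / (y * z))) ^ a =
      (y * z) ^ a * ∫ x in (0 : ℝ)..1, x ^ p * (1 - x) ^ r / (x * (1 - y) + y * z) ^ a := by
  rw [← intervalIntegral.integral_const_mul]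
  refine intervalIntegral.integral_congr fun x _ => ?_
  rw [one_sub_mul_t hy hz, div_pow]
  have : (y * z) ^ a ≠ 0 := pow_ne_zero _ (mul_ne_zero hy hz)
  field_simp

/-- **Rhin–Viola (3.4) multiplied out**: for `0 < y`, `z ≠ 0` with `(y−1)/(yz) < 1`, and `p + r = p' + r'`,
`p'! r'! (yz)^{p'+1} ∫₀¹ x^p(1−x)^r/(x(1−y)+yz)^{p'+1} = p! r! (yz)^{p+1} ∫₀¹ x^{p'}(1−x)^{r'}/(x(1−y)+yz)^{p+1}`.
[cite: RhinViola2005, (3.4)] -/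
theorem euler_integral_symm_denom {p r p' r' : ℕ} (hpr : p + r = p' + r') {y z : ℝ} (hy : 0 < y) (hy1 : y ≤ 1)
    (hz : 0 < z) :
    ((p' ! : ℝ) * r' !) * ((y * z) ^ (p' + 1) * ∫ x in (0 : ℝ)..1, x ^ p * (1 - x) ^ r / (x * (1 - y) + y * z) ^ (p' + 1)) =
      ((p ! : ℝ) * r !) * ((y * z) ^ (p + 1) * ∫ x in (0 : ℝ)..1, x ^ p' * (1 - x) ^ r' / (x * (1 - y) + y * z) ^ (p + 1)) := by
  have ht : (y - 1) / (y * z) < 1 := by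
    rw [div_lt_one (mul_pos hy hz)]
    nlinarith [mul_pos hy hz]
  have := euler_integral_symm_nat hpr ht
  rwa [euler_integral_denom hy.ne' hz.ne', euler_integral_denom hy.ne' hz.ne'] at this

end RhinViola

namespace ViolaZudilin

open RhinViola (integrand integrableOn_integrand euler_integral_symm_denom)
open Finset

variable {z : ℝ}

/-- The `x`-section of the VZ integrand for `0 < y < 1`, `z > 0`, `m ≤ j+k`:
`∫₀¹ integrand·(1−y+yz)^N dx = y^k(1−y)^l(1−y+yz)^N ∫₀¹ x^j(1−x)^h dx/(x(1−y)+yz)^{j+k−m+1}`.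
[cite: ViolaZudilin2018, §2.1] -/
theorem setIntegral_section_eq {y : ℝ} (hy : y ∈ Ioo (0 : ℝ) 1) (hz : 0 < z) {j k m : ℕ} (hm : m ≤ j + k)
    (h l N : ℕ) :
    ∫ x in Icc (0 : ℝ) 1, integrand z h j k l m (x, y) * denom₂ z (x, y) ^ N =
      y ^ k * (1 - y) ^ l * denom₂ z (0, y) ^ N *
        ∫ x in (0 : ℝ)..1, x ^ j * (1 - x) ^ h / (x * (1 - y) + y * z) ^ (j + k - m + 1) := by
  rw [integral_Icc_eq_integral_Ioc, ← intervalIntegral.integral_of_le zero_le_one,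
    ← intervalIntegral.integral_const_mul]
  refine intervalIntegral.integral_congr fun x hx => ?_
  rw [Set.uIcc_of_le zero_le_one] at hx
  have hD : x * (1 - y) + y * z ≠ 0 := by nlinarith [hx.1, hy.1, hy.2, mul_pos hy.1 hz]
  simp only [integrand, denom₁, denom₂]
  rw [show j + k + 1 = m + (j + k - m + 1) by omega, pow_add]
  field_simp

/-- **Viola–Zudilin Lemma 3.2 (`μ = 0`, real `z > 1`) / Rhin–Viola (3.5)**: for `k ≤ h+m`, `m ≤ j+k`, `m ≤ j+q`,
`(h+m−k)! (j+k−m)! · J_z^{(0)}(h,j,k,l,m,q) = h! j! · J_z^{(0)}(h+m−k, j+k−m, m, l, k, q)`.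
[cite: ViolaZudilin2018, Lemma 3.2] -/
theorem J₀_phi (hz : 1 < z) {h j k m q : ℕ} (hk : k ≤ h + m) (hm : m ≤ j + k) (hq : m ≤ j + q) (l : ℕ) :
    (((h + m - k)! : ℝ) * (j + k - m)!) * J₀ z h j k l m q =
      ((h ! : ℝ) * j !) * J₀ z (h + m - k) (j + k - m) m l k q := by
  have hz0 : 0 < z := by linarith
  set n := j + k - m with hn
  set h' := h + m - k with hh'
  have hN : j + k - m + q - k = j + q - m := by omega
  -- Fubini for both sides
  have hF : ∀ (a b c d e N : ℕ), ∫ p in unitSquare, integrand z a b c d e p * denom₂ z p ^ N =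
      ∫ y in Icc (0 : ℝ) 1, ∫ x in Icc (0 : ℝ) 1, integrand z a b c d e (x, y) * denom₂ z (x, y) ^ N := by
    intro a b c d e N
    have hint : Integrable (fun p => integrand z a b c d e p * denom₂ z p ^ N)
        (((volume : Measure ℝ).restrict (Icc 0 1)).prod ((volume : Measure ℝ).restrict (Icc 0 1))) := by
      have hi : IntegrableOn (fun p => integrand z a b c d e p * denom₂ z p ^ N) unitSquare volume := by
        refine Integrable.mul_of_top_left (integrableOn_integrand hz.le a b c d e) ?_
        refine memLp_top_of_bound ((continuous_denom₂ z).pow N).aestronglyMeasurable (z ^ N)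
          ((ae_restrict_iff' measurableSet_unitSquare).2 (Filter.Eventually.of_forall fun p hp => ?_))
        rw [Real.norm_eq_abs, abs_pow]
        refine pow_le_pow_left₀ (abs_nonneg _) ?_ N
        rw [mem_unitSquare] at hp
        rw [denom₂, abs_of_nonneg (by nlinarith [hp.2.1, hp.2.2])]
        nlinarith [hp.2.1, hp.2.2]
      rwa [IntegrableOn, volume_restrict_unitSquare] at hi
    rw [show (∫ p in unitSquare, integrand z a b c d e p * denom₂ z p ^ N) =
        ∫ p, integrand z a b c d e p * denom₂ z p ^ N
          ∂((volume : Measure ℝ).restrict (Icc 0 1)).prod ((volume : Measure ℝ).restrict (Icc 0 1)) by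
      rw [← volume_restrict_unitSquare]]
    exact integral_prod_symm _ hint
  -- pointwise identity of the `y`-integrands on `(0,1)`
  have hpt : EqOn
      (fun y : ℝ => (((h' ! : ℝ) * n !) * z ^ ((k : ℤ) - l - q)) *
        ∫ x in Icc (0 : ℝ) 1, integrand z h j k l m (x, y) * denom₂ z (x, y) ^ (j + q - m))
      (fun y : ℝ => (((h ! : ℝ) * j !) * z ^ ((m : ℤ) - l - q)) *
        ∫ x in Icc (0 : ℝ) 1, integrand z h' n m l k (x, y) * denom₂ z (x, y) ^ (j + q - m)) (Ioo (0 : ℝ) 1) := by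
    intro y hy
    have hy0 : y ≠ 0 := hy.1.ne'
    simp only
    rw [setIntegral_section_eq hy hz0 hm, setIntegral_section_eq hy hz0 (by omega : k ≤ n + m),
      show n + m - k + 1 = j + 1 by omega]
    -- (3.4): `n! h'! (yz)^{n+1} Φ₁ = j! h! (yz)^{j+1} Φ₂`
    have key := euler_integral_symm_denom (p := j) (r := h) (p' := n) (r' := h') (by omega) hy.1 hy.2.le hz0
    -- `z^{k−l−q} y^k (yz)^{−(n+1)} = z^{m−l−q} y^m (yz)^{−(j+1)}`
    have hyz : (y * z) ^ (n + 1) ≠ 0 := pow_ne_zero _ (mul_ne_zero hy0 hz0.ne')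
    have hyz' : (y * z) ^ (j + 1) ≠ 0 := pow_ne_zero _ (mul_ne_zero hy0 hz0.ne')
    have hexp : y ^ k * z ^ ((k : ℤ) - l - q) * (y * z) ^ (j + 1) = y ^ m * z ^ ((m : ℤ) - l - q) * (y * z) ^ (n + 1) := by
      rw [show ((k : ℤ) - l - q) = (k : ℤ) - (l + q : ℕ) by push_cast; ring,
        show ((m : ℤ) - l - q) = (m : ℤ) - (l + q : ℕ) by push_cast; ring, zpow_sub₀ hz0.ne', zpow_sub₀ hz0.ne',
        zpow_natCast, zpow_natCast, zpow_natCast]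
      have hp : y ^ k * z ^ k * (y * z) ^ (j + 1) = y ^ m * z ^ m * (y * z) ^ (n + 1) := by
        rw [← mul_pow, ← mul_pow, ← pow_add, ← pow_add, show k + (j + 1) = m + (n + 1) by omega]
      field_simp
      linear_combination hp
    set Φ₁ := ∫ x in (0 : ℝ)..1, x ^ j * (1 - x) ^ h / (x * (1 - y) + y * z) ^ (n + 1) with hΦ₁
    set Φ₂ := ∫ x in (0 : ℝ)..1, x ^ n * (1 - x) ^ h' / (x * (1 - y) + y * z) ^ (j + 1) with hΦ₂
    -- assemble: multiply through by `(yz)^{n+1}(yz)^{j+1}`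
    refine mul_right_cancel₀ (mul_ne_zero hyz hyz') ?_
    linear_combination (z ^ ((k : ℤ) - l - q) * y ^ k * (y * z) ^ (j + 1) * (1 - y) ^ l *
      denom₂ z (0, y) ^ (j + q - m)) * key + ((j ! : ℝ) * h ! * (y * z) ^ (j + 1) * Φ₂ * (1 - y) ^ l *
        denom₂ z (0, y) ^ (j + q - m)) * hexp
  -- integrate
  rw [J₀, J₀, hN, hF, hF, integral_Icc_eq_integral_Ioo, integral_Icc_eq_integral_Ioo (f := fun y =>
    ∫ x in Icc (0 : ℝ) 1, integrand z h' n m l k (x, y) * denom₂ z (x, y) ^ (j + q - m))]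
  have e := setIntegral_congr_fun (μ := volume) measurableSet_Ioo hpt
  rw [MeasureTheory.integral_const_mul, MeasureTheory.integral_const_mul] at e
  linear_combination e

end ViolaZudilin

end Literature.NumberTheory.DiophantineApproximation

end
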